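import Literature.NumberTheory.ConnesConsani2021.ProlateSincOperator
import Literature.NumberTheory.ConnesConsani2021.SoninTraceReduction
import Literature.Analysis.Fourier.L2FourierReflection
import HarnessLib

/-!
# The dual cutoff `𝒫̂₁ = 𝓕⁻¹ 1_{[−1,1]} 𝓕` on `L²(ℝ)` is convolution with the sinc kernel

LINE 1 — FRAMING: RH-FREE classical Fourier analysis (an `L²` Fourier multiplier whose symbol is the
indicator of a bounded interval acts as convolution with the square integrable inverse transform of the
symbol); cell rh-crit, corpus C1, seat gm-t14 (lead R61 (2)), consumed by t1 (k-2) /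
gm-t15 (op-4) in the `CC2021_prop_2_2_iii` programme; bears_on: W-C/W-P (apex (A), K1).
WHAT THIS IS NOT: any claim about RH — nothing here bears on the truth of RH.

Topic `NumberTheory/ConnesConsani2021`; namespace `Literature.NumberTheory.ConnesConsani2021`.  Theorems
only: no definition, no named fact, no instance, no `sorry`.

For Connes–Consani's cutoff projections (`ProlateProjections`: `cutoffProj Λ` = multiplication by
`1_{[−Λ,Λ]}`, `cutoffProjHat Λ = 𝓕⁻¹ ∘ cutoffProj Λ ∘ 𝓕`, `outerProjHat = 1 − cutoffProjHat 1`, all on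
Mathlib's `Lp ℂ 2 volume` with Mathlib's unitary `L²` Fourier transform, kernel `e^{−2πixξ}` = CC's
eq. (13)) and seat t10's kernel `sincKernel v = ∫_{−1}^{1} e^{2πiξv} dξ` (`= sin(2πv)/(πv)`,
`ProlateSincOperator`), we prove the a.e. KERNEL FORMULA on all of `L²(ℝ)`:

* `cutoffProjHat_one_coeFn` — `(𝒫̂₁ φ)(x) = ∫ κ(x − y) φ(y) dy` for a.e. `x`, for every `φ ∈ L²(ℝ)`;
* `outerProjHat_coeFn` — `(P̂ φ)(x) = φ(x) − ∫ κ(x − y) φ(y) dy` a.e. (CC's `𝐏̂ = id − D ∗ ·`,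
  `D(t) = sin(2πt)/(πt)`, §4 p. 15 eq. (complementproj));
* `integrable_sincKernel_sub_mul`, `memLp_sincKernel_sub` — the integral converges absolutely for EVERY
  `x` (`κ(x − ·) ∈ L²`, Cauchy–Schwarz), so no principal values are involved;
* `integral_sincKernel_sub_mul_eq` — the pointwise identity `∫ κ(x − y) φ(y) dy = 𝓕(1_{[−1,1]}·𝓕⁻¹φ)(x)`
  (a genuine Fourier integral of an `L¹ ∩ L²` function), valid for every `x`;
* `fourier_cutoffProj_fourierInv` — the operator identity `𝓕 ∘ 𝒫_Λ ∘ 𝓕⁻¹ = 𝓕⁻¹ ∘ 𝒫_Λ ∘ 𝓕 (= 𝒫̂_Λ)`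
  on `L²(ℝ)` (the window is even), with `compNeg_cutoffProj` (`𝒫_Λ` commutes with `u ↦ u(−·)`);
* (append #1, for seat t1's step (k-2)) `soninProjection_zero_zero_coeFn` — the even projection
  `E = 𝐒(0,0)` is `(Eu)(x) = ½(u(x) + u(−x))` a.e.; `soninProjection_one_zero_coeFn` — `𝐏₁₀ = (1 − 𝒫₁)E`
  is `1_{|x| ≥ 1}·½(u(x) + u(−x))` a.e. (the tree's `cutoffP`); `soninProjection_zero_one_coeFn` —
  `𝐏₀₁ = (1 − 𝒫̂₁)E` is `e(x) − ∫ κ(x − y) e(y) dy` a.e., `e = ½(u + u(−·))`, for EVERY `u ∈ L²(ℝ)`.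

Route (no Fubini, no density argument): `κ(x − ·)` is, pointwise, the Fourier integral of the phase-shifted
window `f_x(ξ) = 1_{[−1,1]}(ξ)e^{2πiξx} ∈ L¹ ∩ L²` (`fourierIntegral_phaseWindow`); hence
`∫ κ(x−y)φ(y)dy = ⟪𝓕f_x, φ⟫ = ⟪f_x, 𝓕⁻¹φ⟫` (unitarity, `MeasureTheory.Lp.inner_fourier_eq`)
`= 𝓕(1_{[−1,1]}𝓕⁻¹φ)(x)`; the `L²` transform of the `L¹ ∩ L²` class `𝒫₁𝓕⁻¹φ` is a.e. this Fourier
integral (tree `FourierNS.fourier_toLp_ae_eq`); and `𝓕𝒫₁𝓕⁻¹ = 𝒫̂₁` by the reflection identities of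
`Literature.Analysis.Fourier.L2FourierReflection` (seat gm-t15).

## References

* A. Connes, C. Consani, *Weil positivity and trace formula, the archimedean place*, Selecta Math. 27
  (2021), §4 p. 15 eq. (complementproj), p. 16 eq. (prolateeq) (arXiv:2006.13771 p0015:L42–L48,
  p0016:L13–L34). [ConnesConsani2021]
* L. Grafakos, *Classical Fourier Analysis*, 3rd ed., GTM 249 (2014), Thm. 2.2.14 (Plancherel, unitarity),
  §2.2.4 (the `L²` transform on `L¹ ∩ L²`), Prop. 2.2.11 (PDF pp. 126–130). [Grafakos2014]
* D. Slepian, H. O. Pollak, Bell System Tech. J. 40 (1961) 43–63, §III (the kernel `sin c(y−x)/(π(y−x))`).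
  [SlepianPollak1961]
-/

noncomputable section

open MeasureTheory Complex Set Filter
open scoped Real ComplexConjugate InnerProductSpace Topology FourierTransform ENNReal

namespace Literature.NumberTheory.ConnesConsani2021

open Literature.Analysis.FluidPDE.FourierNS Literature.Analysis.Fourier

/-! ## The phase-shifted window `f_x(ξ) = 1_{[−1,1]}(ξ) e^{2πiξx}` and its Fourier integral `κ(x − ·)` -/

/-- `𝓕(1_{[−1,1]} e^{2πi·x})(y) = κ(x − y)` (pointwise, every `x, y`).
[cite: ConnesConsani2021, §4 p. 16 eq. (prolateeq) (arXiv p0016:L13–L34); SlepianPollak1961, §III] -/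
theorem fourierIntegral_phaseWindow (x y : ℝ) :
    𝓕 (fun ξ : ℝ => (Icc (-1 : ℝ) 1).indicator (fun ξ : ℝ => cexp (2 * π * I * ξ * x)) ξ) y =
      sincKernel (x - y) := by
  rw [Real.fourier_real_eq_integral_exp_smul, sincKernel_sub_eq_integral,
    intervalIntegral.integral_of_le (by norm_num : (-1 : ℝ) ≤ 1), ← integral_Icc_eq_integral_Ioc,
    ← integral_indicator measurableSet_Icc]
  refine integral_congr_ae (Eventually.of_forall fun ξ => ?_)
  dsimp only
  by_cases hξ : ξ ∈ Icc (-1 : ℝ) 1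
  · rw [indicator_of_mem hξ, indicator_of_mem hξ, smul_eq_mul, mul_comm]
    congr 2
    push_cast
    ring
  · rw [indicator_of_notMem hξ, indicator_of_notMem hξ, smul_zero]

/-- The window `1_{[−1,1]} e^{2πi·x}` is integrable. [cite: Grafakos2014, §2.2.4, PDF pp. 129–130] -/
theorem integrable_phaseWindow (x : ℝ) :
    Integrable (fun ξ : ℝ => (Icc (-1 : ℝ) 1).indicator (fun ξ : ℝ => cexp (2 * π * I * ξ * x)) ξ) := by
  rw [integrable_indicator_iff measurableSet_Icc]
  exact (by fun_prop : Continuous fun ξ : ℝ => cexp (2 * π * I * ξ * x)).integrableOn_Icc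

/-- The window `1_{[−1,1]} e^{2πi·x}` is square integrable. [cite: Grafakos2014, §2.2.4, PDF pp. 129–130] -/
theorem memLp_phaseWindow (x : ℝ) :
    MemLp (fun ξ : ℝ => (Icc (-1 : ℝ) 1).indicator (fun ξ : ℝ => cexp (2 * π * I * ξ * x)) ξ) 2 volume := by
  rw [memLp_indicator_iff_restrict measurableSet_Icc]
  have hc : Continuous fun ξ : ℝ => cexp (2 * π * I * ξ * x) := by fun_prop
  refine (memLp_top_of_bound hc.aestronglyMeasurable 1 (Eventually.of_forall fun ξ => ?_)).mono_exponent
    le_top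
  rw [norm_exp]
  apply le_of_eq
  rw [Real.exp_eq_one_iff]
  simp [mul_comm]

/-- **`κ(x − ·) ∈ L²(ℝ)`** (it is the Fourier transform of the `L¹ ∩ L²` window).
[cite: Grafakos2014, Thm. 2.2.14, PDF p. 128; SlepianPollak1961, §III] -/
theorem memLp_sincKernel_sub (x : ℝ) : MemLp (fun y : ℝ => sincKernel (x - y)) 2 volume := by
  have h := memLp_two_fourierIntegral (integrable_phaseWindow x) (memLp_phaseWindow x)
  refine h.ae_eq (Eventually.of_forall fun y => ?_)
  exact fourierIntegral_phaseWindow x y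

/-- **The convolution integral `∫ κ(x − y) φ(y) dy` converges absolutely for every `x`**, for
`φ ∈ L²(ℝ)` (Cauchy–Schwarz). [cite: Grafakos2014, Thm. 2.2.14, PDF p. 128; ConnesConsani2021, §4 p. 16 eq. (prolateeq)] -/
theorem integrable_sincKernel_sub_mul (φ : Lp ℂ 2 (volume : Measure ℝ)) (x : ℝ) :
    Integrable (fun y : ℝ => sincKernel (x - y) * φ y) :=
  (memLp_sincKernel_sub x).integrable_mul (Lp.memLp φ)

/-! ## The pointwise identity `∫ κ(x − y) φ(y) dy = 𝓕(1_{[−1,1]} 𝓕⁻¹φ)(x)` -/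

/-- The indicator of `[−1,1]` times an `L²` function is integrable. [cite: Grafakos2014, §2.2.4, PDF pp. 129–130] -/
theorem integrable_indicator_Icc_coeFn (V : Lp ℂ 2 (volume : Measure ℝ)) :
    Integrable ((Icc (-1 : ℝ) 1).indicator (V : ℝ → ℂ)) := by
  rw [integrable_indicator_iff measurableSet_Icc, IntegrableOn, ← memLp_one_iff_integrable]
  exact ((Lp.memLp V).restrict (Icc (-1 : ℝ) 1)).mono_exponent one_le_two

/-- The indicator of `[−1,1]` times an `L²` function is square integrable. [cite: Grafakos2014, §2.2.4, PDF pp. 129–130] -/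
theorem memLp_indicator_Icc_coeFn (V : Lp ℂ 2 (volume : Measure ℝ)) :
    MemLp ((Icc (-1 : ℝ) 1).indicator (V : ℝ → ℂ)) 2 volume :=
  (Lp.memLp V).indicator measurableSet_Icc

/-- `𝒫₁ V` is the `L²` class of `1_{[−1,1]} V`. [cite: ConnesConsani2021, §4 p. 15 eq. (complementproj) (arXiv p0015:L42–L48)] -/
theorem cutoffProj_one_eq_toLp (V : Lp ℂ 2 (volume : Measure ℝ)) :
    cutoffProj 1 V = (memLp_indicator_Icc_coeFn V).toLp _ := by
  refine Lp.ext ?_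
  filter_upwards [cutoffProj_coeFn 1 V, (memLp_indicator_Icc_coeFn V).coeFn_toLp] with ξ h1 h2
  rw [h1, h2]

/-- **`∫ κ(x − y) φ(y) dy = 𝓕(1_{[−1,1]}·𝓕⁻¹φ)(x)` for every `x`** (`κ(x−·) = 𝓕 f_x`, unitarity
`⟪𝓕 f_x, φ⟫ = ⟪f_x, 𝓕⁻¹φ⟫`). [cite: Grafakos2014, Thm. 2.2.14 (2)–(3), PDF p. 128; §2.2.4, PDF p. 130] -/
theorem integral_sincKernel_sub_mul_eq (φ : Lp ℂ 2 (volume : Measure ℝ)) (x : ℝ) :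
    ∫ y, sincKernel (x - y) * φ y =
      𝓕 ((Icc (-1 : ℝ) 1).indicator ((𝓕⁻ φ : Lp ℂ 2 (volume : Measure ℝ)) : ℝ → ℂ)) x := by
  set F : Lp ℂ 2 (volume : Measure ℝ) := (memLp_phaseWindow x).toLp _ with hF
  have hFf : (F : ℝ → ℂ) =ᵐ[volume]
      fun ξ : ℝ => (Icc (-1 : ℝ) 1).indicator (fun ξ : ℝ => cexp (2 * π * I * ξ * x)) ξ :=
    (memLp_phaseWindow x).coeFn_toLp
  have hFF : ((𝓕 F : Lp ℂ 2 (volume : Measure ℝ)) : ℝ → ℂ) =ᵐ[volume] fun y => sincKernel (x - y) := by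
    filter_upwards [fourier_toLp_ae_eq (integrable_phaseWindow x) (memLp_phaseWindow x)] with y hy
    rw [hy, fourierIntegral_phaseWindow]
  -- `∫ κ(x − y) φ(y) dy = ⟪𝓕 F, φ⟫`
  have h1 : ∫ y, sincKernel (x - y) * φ y = ⟪(𝓕 F : Lp ℂ 2 (volume : Measure ℝ)), φ⟫_ℂ := by
    rw [L2.inner_def]
    refine integral_congr_ae ?_
    filter_upwards [hFF] with y hy
    rw [hy, RCLike.inner_apply, conj_sincKernel, mul_comm]
  -- unitarity
  have h2 : ⟪(𝓕 F : Lp ℂ 2 (volume : Measure ℝ)), φ⟫_ℂ =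
      ⟪F, (𝓕⁻ φ : Lp ℂ 2 (volume : Measure ℝ))⟫_ℂ := by
    have hφ : (𝓕 (𝓕⁻ φ : Lp ℂ 2 (volume : Measure ℝ)) : Lp ℂ 2 (volume : Measure ℝ)) = φ :=
      FourierTransform.fourier_fourierInv_eq (F := Lp ℂ 2 (volume : Measure ℝ)) φ
    conv_lhs => rw [← hφ]
    exact Lp.inner_fourier_eq F _
  -- `⟪F, 𝓕⁻¹φ⟫ = 𝓕(1_{[−1,1]} 𝓕⁻¹φ)(x)`
  have h3 : ⟪F, (𝓕⁻ φ : Lp ℂ 2 (volume : Measure ℝ))⟫_ℂ =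
      𝓕 ((Icc (-1 : ℝ) 1).indicator ((𝓕⁻ φ : Lp ℂ 2 (volume : Measure ℝ)) : ℝ → ℂ)) x := by
    rw [L2.inner_def, Real.fourier_real_eq_integral_exp_smul]
    refine integral_congr_ae ?_
    filter_upwards [hFf] with ξ hξ
    rw [hξ, RCLike.inner_apply]
    by_cases hm : ξ ∈ Icc (-1 : ℝ) 1
    · rw [indicator_of_mem hm, indicator_of_mem hm, smul_eq_mul, mul_comm, ← Complex.exp_conj]
      congr 2
      simp only [map_mul, Complex.conj_ofReal, Complex.conj_I, map_ofNat]
      push_cast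
      ring
    · rw [indicator_of_notMem hm, indicator_of_notMem hm, map_zero, mul_zero, smul_zero]
  rw [h1, h2, h3]

/-! ## `𝓕 ∘ 𝒫_Λ ∘ 𝓕⁻¹ = 𝒫̂_Λ` on `L²(ℝ)` -/

/-- `𝒫_Λ` commutes with the reflection `u ↦ u(−·)` (the window `[−Λ, Λ]` is symmetric).
[cite: ConnesConsani2021, §4 p. 15 eq. (complementproj) (arXiv p0015:L42–L48)] -/
theorem compNeg_cutoffProj (Λ : ℝ) (u : Lp ℂ 2 (volume : Measure ℝ)) :
    Lp.compMeasurePreserving (fun x : ℝ => -x) (Measure.measurePreserving_neg (volume : Measure ℝ))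
        (cutoffProj Λ u) =
      cutoffProj Λ (Lp.compMeasurePreserving (fun x : ℝ => -x)
        (Measure.measurePreserving_neg (volume : Measure ℝ)) u) := by
  refine Lp.ext ?_
  have h1 := (Measure.measurePreserving_neg (volume : Measure ℝ)).quasiMeasurePreserving.ae_eq_comp
    (cutoffProj_coeFn Λ u)
  filter_upwards [coeFn_compNeg (cutoffProj Λ u), h1, cutoffProj_coeFn Λ (Lp.compMeasurePreserving
    (fun x : ℝ => -x) (Measure.measurePreserving_neg (volume : Measure ℝ)) u), coeFn_compNeg u]
    with y hy1 hy2 hy3 hy4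
  rw [Function.comp_apply, Function.comp_apply] at hy2
  rw [hy1, hy2, hy3]
  have hmem : -y ∈ Icc (-Λ) Λ ↔ y ∈ Icc (-Λ) Λ := by
    rw [mem_Icc, mem_Icc]; constructor <;> rintro ⟨h1, h2⟩ <;> constructor <;> linarith
  by_cases hy : y ∈ Icc (-Λ) Λ
  · rw [indicator_of_mem (hmem.2 hy), indicator_of_mem hy, hy4]
  · rw [indicator_of_notMem (fun h => hy (hmem.1 h)), indicator_of_notMem hy]

/-- **`𝓕 (𝒫_Λ (𝓕⁻¹ φ)) = 𝒫̂_Λ φ = 𝓕⁻¹ (𝒫_Λ (𝓕 φ))`** on `L²(ℝ)` (`𝓕⁻¹ = R𝓕 = 𝓕R`, `R𝒫_Λ = 𝒫_Λ R`).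
[cite: Grafakos2014, §2.2.4, PDF p. 130; ConnesConsani2021, §4 p. 15 eq. (complementproj)] -/
theorem fourier_cutoffProj_fourierInv (Λ : ℝ) (φ : Lp ℂ 2 (volume : Measure ℝ)) :
    (𝓕 (cutoffProj Λ (𝓕⁻ φ : Lp ℂ 2 (volume : Measure ℝ))) : Lp ℂ 2 (volume : Measure ℝ)) =
      cutoffProjHat Λ φ := by
  rw [cutoffProjHat_apply, fourierInv_eq_compNeg_fourier φ, ← compNeg_cutoffProj,
    fourier_compNeg_eq_fourierInv]

/-! ## The kernel formula -/

/-- **`(𝒫̂₁ φ)(x) = ∫ κ(x − y) φ(y) dy` for a.e. `x`, for every `φ ∈ L²(ℝ)`** — the dual cutoff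
`𝓕⁻¹ 1_{[−1,1]} 𝓕` is convolution with the sinc kernel `κ(v) = sin(2πv)/(πv)`.
[cite: ConnesConsani2021, §4 p. 15 eq. (complementproj), p. 16 eq. (prolateeq) (arXiv p0015:L42–p0016:L34); Grafakos2014, §2.2.4, PDF p. 130] -/
theorem cutoffProjHat_one_coeFn (φ : Lp ℂ 2 (volume : Measure ℝ)) :
    (cutoffProjHat 1 φ : ℝ → ℂ) =ᵐ[volume] fun x => ∫ y, sincKernel (x - y) * φ y := by
  rw [← fourier_cutoffProj_fourierInv 1 φ, cutoffProj_one_eq_toLp]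
  filter_upwards [fourier_toLp_ae_eq (integrable_indicator_Icc_coeFn (𝓕⁻ φ : Lp ℂ 2 (volume : Measure ℝ)))
    (memLp_indicator_Icc_coeFn (𝓕⁻ φ : Lp ℂ 2 (volume : Measure ℝ)))] with x hx
  rw [hx, integral_sincKernel_sub_mul_eq]

/-- **`(P̂ φ)(x) = φ(x) − ∫ κ(x − y) φ(y) dy` a.e.**: Connes–Consani's `𝐏̂ = 1 − 𝒫̂₁` is
`id −` convolution with `D(t) = sin(2πt)/(πt)`. [cite: ConnesConsani2021, §4 p. 15 eq. (complementproj) (arXiv p0015:L42–L48)] -/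
theorem outerProjHat_coeFn (φ : Lp ℂ 2 (volume : Measure ℝ)) :
    (outerProjHat φ : ℝ → ℂ) =ᵐ[volume] fun x => φ x - ∫ y, sincKernel (x - y) * φ y := by
  rw [outerProjHat_apply]
  filter_upwards [Lp.coeFn_sub φ (cutoffProjHat 1 φ), cutoffProjHat_one_coeFn φ] with x h1 h2
  rw [h1, Pi.sub_apply, h2]

/-! ## Append #1: the projections `E = 𝐒(0,0)`, `𝐏₁₀ = 𝐒(1,0)`, `𝐏₀₁ = 𝐒(0,1)` at the level of functions -/

section EvenProjection

/-- **The even projection `E = 𝐒(0,0)` acts as `(E u)(x) = ½(u(x) + u(−x))` a.e.**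
[cite: ConnesConsani2021, §4 p. 15 eq. (innerltwoeven) (arXiv p0015:L30–L41)] -/
theorem soninProjection_zero_zero_coeFn (u : Lp ℂ 2 (volume : Measure ℝ)) :
    (soninProjection 0 0 u : ℝ → ℂ) =ᵐ[volume] fun x => 2⁻¹ * (u x + u (-x)) := by
  set R : Lp ℂ 2 (volume : Measure ℝ) →ₗᵢ[ℂ] Lp ℂ 2 (volume : Measure ℝ) :=
    Lp.compMeasurePreservingₗᵢ ℂ (fun x : ℝ => -x) (Measure.measurePreserving_neg (volume : Measure ℝ))
    with hR
  have hRcoe : ∀ w : Lp ℂ 2 (volume : Measure ℝ), (R w : ℝ → ℂ) =ᵐ[volume] fun x => w (-x) := fun w =>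
    Lp.coeFn_compMeasurePreserving w (Measure.measurePreserving_neg (volume : Measure ℝ))
  set v : Lp ℂ 2 (volume : Measure ℝ) := (2⁻¹ : ℂ) • (u + R u) with hv
  have hvcoe : (v : ℝ → ℂ) =ᵐ[volume] fun x => 2⁻¹ * (u x + u (-x)) := by
    filter_upwards [Lp.coeFn_smul (2⁻¹ : ℂ) (u + R u), Lp.coeFn_add u (R u), hRcoe u] with x h1 h2 h3
    rw [h1, Pi.smul_apply, h2, Pi.add_apply, h3, smul_eq_mul]
  have hveven : v ∈ evenPart := by
    rw [mem_evenPart_iff]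
    filter_upwards [hvcoe, (Measure.measurePreserving_neg (volume : Measure ℝ)).quasiMeasurePreserving.ae_eq_comp hvcoe] with x h1 h2
    simp only [Function.comp_apply] at h2
    rw [h2, h1, neg_neg, add_comm]
  have hRR : ∀ w : Lp ℂ 2 (volume : Measure ℝ), R (R w) = w := fun w => by
    refine Lp.ext ?_
    filter_upwards [hRcoe (R w), (Measure.measurePreserving_neg (volume : Measure ℝ)).quasiMeasurePreserving.ae_eq_comp (hRcoe w)] with x h1 h2
    simp only [Function.comp_apply] at h2
    rw [h1, h2, neg_neg]
  have horth : ∀ w ∈ soninSpace 0 0, ⟪u - v, w⟫_ℂ = 0 := by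
    intro w hw
    rw [soninSpace_zero_zero_eq_evenPart] at hw
    have hRw : R w = w := compNeg_eq_self_of_mem_evenPart hw
    have h1 : ⟪R u, w⟫_ℂ = ⟪u, w⟫_ℂ := by
      conv_lhs => rw [← hRw]
      exact R.inner_map_map u w
    have h2 : u - v = (2⁻¹ : ℂ) • (u - R u) := by
      rw [hv]
      module
    rw [h2, inner_smul_left, inner_sub_left, h1, sub_self, mul_zero]
  have hvS : v ∈ soninSpace 0 0 := by rw [soninSpace_zero_zero_eq_evenPart]; exact hveven
  have hE : soninProjection 0 0 u = v := by
    rw [soninProjection]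
    exact Submodule.eq_starProjection_of_mem_of_inner_eq_zero hvS horth
  rw [hE]
  exact hvcoe

/-- **`(𝐏₀₁ u)(x) = e(x) − ∫ κ(x − y) e(y) dy` a.e., `e = ½(u + u(−·))`**: the projection onto
`S(0,1)` is `(1 − 𝒫̂₁) ∘ E` at the level of functions. [cite: ConnesConsani2021, §4 p. 15 eq. (complementproj) (arXiv p0015:L42–L48)] -/
theorem soninProjection_zero_one_coeFn (u : Lp ℂ 2 (volume : Measure ℝ)) :
    (soninProjection 0 1 u : ℝ → ℂ) =ᵐ[volume] fun x =>
      2⁻¹ * (u x + u (-x)) - ∫ y, sincKernel (x - y) * (2⁻¹ * (u y + u (-y))) := by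
  have h1 : soninProjection 0 1 u = outerProjHat (soninProjection 0 0 u) := by
    rw [← soninProjection_apply_soninProjection_zero_zero 0 1 u,
      soninProjection_zero_one_eq_outerProjHat (soninProjection_zero_zero_mem_evenPart u)]
  have h2 : ∀ x, ∫ y, sincKernel (x - y) * (soninProjection 0 0 u : ℝ → ℂ) y =
      ∫ y, sincKernel (x - y) * (2⁻¹ * (u y + u (-y))) := fun x => by
    refine integral_congr_ae ?_
    filter_upwards [soninProjection_zero_zero_coeFn u] with y hy
    rw [hy]
  rw [h1]
  filter_upwards [outerProjHat_coeFn (soninProjection 0 0 u), soninProjection_zero_zero_coeFn u] with x hx hx'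
  rw [hx, hx', h2]

/-- **`(𝐏₁₀ u)(x) = 1_{|x| ≥ 1} · ½(u(x) + u(−x))` a.e.** (the tree's function-level `cutoffP`): the
projection onto `S(1,0)` is `(1 − 𝒫₁) ∘ E` at the level of functions. [cite: ConnesConsani2021, §4 p. 15 eq. (complementproj) (arXiv p0015:L42–L48)] -/
theorem soninProjection_one_zero_coeFn (u : Lp ℂ 2 (volume : Measure ℝ)) :
    (soninProjection 1 0 u : ℝ → ℂ) =ᵐ[volume] cutoffP fun x => 2⁻¹ * (u x + u (-x)) := by
  have h1 : soninProjection 1 0 u = outerProj (soninProjection 0 0 u) := by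
    rw [← soninProjection_apply_soninProjection_zero_zero 1 0 u,
      soninProjection_one_zero_eq_outerProj (soninProjection_zero_zero_mem_evenPart u)]
  rw [h1]
  filter_upwards [outerProj_coeFn (soninProjection 0 0 u), soninProjection_zero_zero_coeFn u] with x hx hx'
  rw [hx]
  simp only [cutoffP, hx']

end EvenProjection

end Literature.NumberTheory.ConnesConsani2021
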